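import Summits.KontsevichZagierPeriods.KontsevichZagierPeriods.Theorems.SymplecticScissorsRealOnePeriodRelationsIsoLayer
import Summits.KontsevichZagierPeriods.KontsevichZagierPeriods.Theorems.SymplecticScissorsRealOnePeriodRelationsStubOvalPath
import Summits.KontsevichZagierPeriods.KontsevichZagierPeriods.Theorems.SymplecticScissorsRealOnePeriodRelationsStubOvalRealise

/-!
# Crux `RealOnePeriodRelations` (stmt-KontsevichZagierPeriods-10042), line `nash-retraction-thin-strip`, reshape 5
# (the unconditional LOOP layer): ARCS, part 1 — the oval arc

An odd oval cell `[∫_{(e₁,e₂)} (P₂√f + P₃/√f)]` on `E_{A,B} : y² = f(x) = x³ + Ax + B` (`e₁ < e₂` consecutive real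
roots, `f > 0` between) is, modulo `M₁`, the real realisation of HALF the CLOSED oval symbol
`(E_{A,B}, (P₂ y + P₃/y) dx, oval)` with the same value (`stub_ovalArc`, registered): the oval loop of `stub_ovalPath`
(`x(t) = e₁ + 16(e₂ − e₁)t²(1 − t)²`, there on `y > 0` and back on `y < 0`), the Bézout normal form `stub_ellForm` of
the elliptic layer, the chain rule on the two open halves (`sum_eval_deriv_eq`), rule 2 along the two halves
(`stub_ovalRealise`) and the value bookkeeping `half_period_eq_value` (the period integrand is real off `t = ½`).
General lemmas used again by the branch arc: `sum_eval_deriv_eq`, `two_mul_deriv_of_sq_eq`, `half_period_eq_value`,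
`hasDerivAt_cubic`. [cite: HuberWustholz2022, §3.3.1 and §13.2] [cite: KontsevichZagier2001, §1.2]
-/

noncomputable section

open scoped BigOperators Polynomial
open Set MeasureTheory MvPolynomial
open Literature.NumberTheory.Transcendental Literature.NumberTheory.Transcendental.CurvePeriods
open Summit.KontsevichZagierPeriods.SymplecticScissors.RealOnePeriodRelationsNegative (M₁ H₁ crux_iff unitDom)

namespace Summit.KontsevichZagierPeriods.SymplecticScissors.RealOnePeriodRelations

namespace LoopLayer

/-- CHAIN-RULE BOOKKEEPING along a path on `E_{A,B}`: if near `t` the path is `u ↦ (X(u), Y(u))` with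
`X′(t) = X'`, `Y′(t) = Y'`, then `Σᵢ ωᵢ(γ(t)) γᵢ′(t) = G(X,Y) X' + H(X,Y) Y'` for `ω = (G, H)`. [folklore] -/
theorem sum_eval_deriv_eq {A B : ℂ} (γ : CurvePath (weierCurve A B)) (G H : MvPolynomial (Fin 2) ℂ) {t : ℝ}
    {X Y : ℝ → ℂ} {X' Y' : ℂ} (hγ : ∀ᶠ u in nhds t, γ.toFun u = ![X u, Y u]) (hX : HasDerivAt X X' t)
    (hY : HasDerivAt Y Y' t) :
    (∑ i, MvPolynomial.eval (γ.toFun t) ((![G, H] : Fin 2 → MvPolynomial (Fin 2) ℂ) i) *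
        deriv (fun u => γ.toFun u i) t) =
      MvPolynomial.eval ![X t, Y t] G * X' + MvPolynomial.eval ![X t, Y t] H * Y' := by
  have h0 : deriv (fun u => γ.toFun u 0) t = X' := by
    rw [Filter.EventuallyEq.deriv_eq (hγ.mono fun u hu => show γ.toFun u 0 = X u by rw [hu]; rfl)]
    exact hX.deriv
  have h1 : deriv (fun u => γ.toFun u 1) t = Y' := by
    rw [Filter.EventuallyEq.deriv_eq (hγ.mono fun u hu => show γ.toFun u 1 = Y u by rw [hu]; rfl)]
    exact hY.deriv
  have ht : γ.toFun t = ![X t, Y t] := hγ.self_of_nhds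
  rw [Fin.sum_univ_two, h0, h1, ht]
  rfl

/-- DIFFERENTIATING THE CURVE EQUATION along a path: if `Y(u)² = f(X(u))` near `t`, then
`2 Y(t) Y′(t) = f′(X(t)) X′(t)`. [folklore] -/
theorem two_mul_deriv_of_sq_eq {A B : ℂ} {X Y : ℝ → ℂ} {X' Y' : ℂ} {t : ℝ}
    (h : ∀ᶠ u in nhds t, Y u ^ 2 = X u ^ 3 + A * X u + B) (hX : HasDerivAt X X' t) (hY : HasDerivAt Y Y' t) :
    2 * Y t * Y' = (3 * X t ^ 2 + A) * X' := by
  have h1 : HasDerivAt (fun u => Y u ^ 2) (2 * Y t * Y') t := by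
    have h : HasDerivAt (fun u => Y u * Y u) (Y' * Y t + Y t * Y') t := hY.mul hY
    have e : (fun u => Y u ^ 2) = fun u => Y u * Y u := funext fun u => sq (Y u)
    rw [e]
    exact h.congr_deriv (by ring)
  have h2 : HasDerivAt (fun u => X u ^ 3 + A * X u + B) ((3 * X t ^ 2 + A) * X') t := by
    refine (((hX.pow 3).add (hX.const_mul A)).add_const B).congr_deriv ?_
    push_cast
    ring
  have h' : (fun u => X u ^ 3 + A * X u + B) =ᶠ[nhds t] (fun u => Y u ^ 2) := h.mono fun u hu => hu.symm
  exact (h1.congr_of_eventuallyEq h').unique h2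

/-- HALF A PERIOD WITH A REAL REALISATION: if the period integrand `Σᵢ ωᵢ(γ) γᵢ′` of a symbol is real-valued on
`(0,1)` off `t = ½` and `R₁` is its realisation with coefficient `½`, then `½ ∫_γ ω = value R₁`. [folklore] -/
theorem half_period_eq_value (sy : PeriodSymbol) (R₁ : KZ.IntegralRep 1)
    (hR₁dom : R₁.domain = {z | z 0 ∈ Set.Ioo (0 : ℝ) 1})
    (hR₁ : ∀ z ∈ R₁.domain, R₁.integrand z =
      ((1 / 2 : ℂ) * ∑ i, MvPolynomial.eval (sy.γ.toFun (z 0)) (sy.ω i) * deriv (fun u => sy.γ.toFun u i) (z 0)).re)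
    (g : ℝ → ℝ) (hreal : ∀ t ∈ Set.Ioo (0 : ℝ) 1, t ≠ 1 / 2 →
      (∑ i, MvPolynomial.eval (sy.γ.toFun t) (sy.ω i) * deriv (fun u => sy.γ.toFun u i) t) = ((g t : ℝ) : ℂ)) :
    (1 / 2 : ℂ) * sy.period = ((R₁.value : ℝ) : ℂ) := by
  have hae : ∀ᵐ t ∂(volume : Measure ℝ), t ∈ Set.Ioo (0 : ℝ) 1 →
      (1 / 2 : ℂ) * (∑ i, MvPolynomial.eval (sy.γ.toFun t) (sy.ω i) * deriv (fun u => sy.γ.toFun u i) t) =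
        ((R₁.integrand (fun _ => t) : ℝ) : ℂ) := by
    have hne : {(1 / 2 : ℝ)}ᶜ ∈ ae (volume : Measure ℝ) := compl_mem_ae_iff.mpr (measure_singleton _)
    filter_upwards [hne] with t ht hmem
    have ht : t ≠ 1 / 2 := ht
    have hz : (fun _ : Fin 1 => t) ∈ R₁.domain := by rw [hR₁dom]; exact hmem
    rw [hR₁ _ hz]
    show (1 / 2 : ℂ) * (∑ i, MvPolynomial.eval (sy.γ.toFun t) (sy.ω i) * deriv (fun u => sy.γ.toFun u i) t) = _
    rw [hreal t hmem ht]
    simp only [Complex.mul_re, Complex.ofReal_re, Complex.ofReal_im, mul_zero, sub_zero]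
    norm_num
  rw [PeriodSymbol.period, ← intervalIntegral.integral_const_mul, RationalLayer.value_of_unitCell R₁ hR₁dom,
    ← intervalIntegral.integral_ofReal, intervalIntegral.integral_of_le zero_le_one,
    intervalIntegral.integral_of_le zero_le_one, integral_Ioc_eq_integral_Ioo, integral_Ioc_eq_integral_Ioo]
  exact setIntegral_congr_ae measurableSet_Ioo hae

/-- The derivative of `f = x³ + Ax + B`. [folklore] -/
theorem hasDerivAt_cubic (A B v : ℝ) : HasDerivAt (fun v : ℝ => v ^ 3 + A * v + B) (3 * v ^ 2 + A) v := by
  refine ((((hasDerivAt_id v).pow 3).add ((hasDerivAt_id v).const_mul A)).add_const B).congr_deriv ?_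
  simp only [id]
  push_cast
  ring

/-- The oval parametrisation `x(t) = e₁ + 16(e₂ − e₁)t²(1 − t)²` and its derivative
`x′(t) = 32(e₂ − e₁) t(1 − t)(1 − 2t)`. [folklore] -/
theorem hasDerivAt_ovalChart (e₁ e₂ t : ℝ) :
    HasDerivAt (fun u : ℝ => e₁ + (e₂ - e₁) * (16 * u ^ 2 * (1 - u) ^ 2))
      ((e₂ - e₁) * (32 * t * (1 - t) * (1 - 2 * t))) t := by
  have e : (fun u : ℝ => e₁ + (e₂ - e₁) * (16 * u ^ 2 * (1 - u) ^ 2)) =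
      fun u => e₁ + (e₂ - e₁) * (16 * (u * u) * ((1 - u) * (1 - u))) := by
    funext u; ring
  rw [e]
  have hid : HasDerivAt (fun u : ℝ => u) 1 t := hasDerivAt_id t
  have h1m : HasDerivAt (fun u : ℝ => 1 - u) (0 - 1) t := (hasDerivAt_const t (1 : ℝ)).sub hid
  have hsq : HasDerivAt (fun u : ℝ => u * u) (1 * t + t * 1) t := hid.mul hid
  have hsq' : HasDerivAt (fun u : ℝ => (1 - u) * (1 - u)) ((0 - 1) * (1 - t) + (1 - t) * (0 - 1)) t :=
    h1m.mul h1m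
  have hprod : HasDerivAt (fun u : ℝ => 16 * (u * u) * ((1 - u) * (1 - u)))
      (16 * (1 * t + t * 1) * ((1 - t) * (1 - t)) + 16 * (t * t) * ((0 - 1) * (1 - t) + (1 - t) * (0 - 1))) t :=
    (hsq.const_mul 16).mul hsq'
  exact ((hprod.const_mul (e₂ - e₁)).const_add e₁).congr_deriv (by ring)

/-- The oval chart maps `(0,1) ∖ {½}` into `(e₁, e₂)`: `0 < 16t²(1−t)² < 1` there. [folklore] -/
theorem ovalChart_mem {e₁ e₂ : ℝ} (hlt : e₁ < e₂) {t : ℝ} (ht : t ∈ Set.Ioo (0 : ℝ) 1) (ht2 : t ≠ 1 / 2) :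
    e₁ + (e₂ - e₁) * (16 * t ^ 2 * (1 - t) ^ 2) ∈ Set.Ioo e₁ e₂ := by
  have h1 : 0 < 16 * t ^ 2 * (1 - t) ^ 2 := by
    have := ht.1; have := ht.2; positivity
  have h2 : 16 * t ^ 2 * (1 - t) ^ 2 < 1 := by
    have hq : 0 < (2 * t - 1) ^ 2 := by
      have : 2 * t - 1 ≠ 0 := fun h => ht2 (by linarith)
      positivity
    have hq1 : (2 * t - 1) ^ 2 < 1 := by nlinarith [ht.1, ht.2]
    have e : 16 * t ^ 2 * (1 - t) ^ 2 = (1 - (2 * t - 1) ^ 2) ^ 2 := by ring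
    rw [e]
    nlinarith
  have hba : 0 < e₂ - e₁ := sub_pos.2 hlt
  constructor <;> nlinarith [mul_pos hba h1, mul_pos hba (sub_pos.2 h2)]

/-- **Stub `stub_ovalArc`** (registered, lead) — THE OVAL ARC. An odd oval cell `[∫_{(e₁,e₂)} (P₂√f + P₃/√f)]` on `E_{A,B}` is, modulo `M₁`, the real realisation of
HALF the closed oval symbol `(E_{A,B}, (P₂ y + P₃/y) dx, oval)`, with the same value. [cite: HuberWustholz2022, §3.3.1 and §13.2] -/
theorem stub_ovalArc : ∀ (A B : ℝ), IsAlgebraic ℚ A → IsAlgebraic ℚ B → 4 * A ^ 3 + 27 * B ^ 2 ≠ 0 →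
    ∀ (ρ : KZ.IntegralRep 1) {e₁ e₂ : ℝ}, IsAlgebraic ℚ e₁ → IsAlgebraic ℚ e₂ → e₁ < e₂ →
    e₁ ^ 3 + A * e₁ + B = 0 → e₂ ^ 3 + A * e₂ + B = 0 →
    (∀ x ∈ Set.Ioo e₁ e₂, 0 < x ^ 3 + A * x + B) → ρ.domain = {z | z 0 ∈ Set.Ioo e₁ e₂} →
    ∀ (P₂ P₃ : Polynomial (algebraicClosure ℚ ℝ)),
    (∀ x ∈ Set.Ioo e₁ e₂, ρ.integrand (fun _ => x) =
      Polynomial.aeval x P₂ * Real.sqrt (x ^ 3 + A * x + B) + Polynomial.aeval x P₃ / Real.sqrt (x ^ 3 + A * x + B)) →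
    ∃ (C : PeriodSymbol →₀ ℂ) (R : PeriodSymbol → KZ.IntegralRep 1), (∀ s, IsAlgebraic ℚ (C s)) ∧
      (∀ s ∈ C.support, s.Z = weierCurve (A : ℂ) (B : ℂ) ∧ s.γ.toFun 1 = s.γ.toFun 0) ∧
      (∀ s ∈ C.support, IsSemialgebraicMapOn ℚ {z : Fin 1 → ℝ | z 0 ∈ Set.Icc (0 : ℝ) 1}
        (fun z => Fin.append (fun i => (s.γ.toFun (z 0) i).re) (fun i => (s.γ.toFun (z 0) i).im))) ∧
      (∀ s ∈ C.support, (R s).domain = {z | z 0 ∈ Set.Ioo (0 : ℝ) 1} ∧ ∀ z ∈ (R s).domain, (R s).integrand z =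
        (C s * ∑ i, MvPolynomial.eval (s.γ.toFun (z 0)) (s.ω i) * deriv (fun u => s.γ.toFun u i) (z 0)).re) ∧
      evalCombination C = ((ρ.value : ℝ) : ℂ) ∧ KZ.of ρ - ∑ s ∈ C.support, KZ.of (R s) ∈ M₁ := by
  classical
  intro A B hA hB hD ρ e₁ e₂ he₁ he₂ hlt hf₁ hf₂ hpos hdom P₂ P₃ hint
  obtain ⟨γ, hcl, hγ₁, hγ₂, hSA⟩ := stub_ovalPath A B e₁ e₂ hA hB he₁ he₂ hlt hD hf₁ hf₂ hpos
  obtain ⟨G, H, hG, hH, hGH⟩ := EllipticLayer.stub_ellForm A B hA hB hD 0 P₂ P₃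
  have hA' : IsAlgebraic ℚ (A : ℂ) := hA.algebraMap
  have hB' : IsAlgebraic ℚ (B : ℂ) := hB.algebraMap
  have hD' : Weier.disc (A : ℂ) (B : ℂ) ≠ 0 := by
    unfold Weier.disc
    exact_mod_cast hD
  have hω : ∀ i, HasAlgCoeffs ((![G, H] : Fin 2 → MvPolynomial (Fin 2) ℂ) i) := by
    intro i
    fin_cases i
    · exact hG
    · exact hH
  set sy : PeriodSymbol := ⟨weierCurve (A : ℂ) (B : ℂ), Weier.isSmoothAffineCurve (A : ℂ) (B : ℂ) hA' hB' hD',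
    ![G, H], hω, γ⟩ with hsy
  have hhalf : IsAlgebraic ℚ (1 / 2 : ℂ) := by
    rw [one_div]; exact (isAlgebraic_nat 2).inv
  obtain ⟨R₁, hR₁dom, hR₁⟩ := stub_realises sy.Z sy.γ hSA sy.ω sy.ω_algebraic (1 / 2) hhalf
  -- notation for the chart, its derivative and the cubic
  set x : ℝ → ℝ := fun u => e₁ + (e₂ - e₁) * (16 * u ^ 2 * (1 - u) ^ 2) with hx
  set xd : ℝ → ℝ := fun u => (e₂ - e₁) * (32 * u * (1 - u) * (1 - 2 * u)) with hxd
  set f : ℝ → ℝ := fun v => v ^ 3 + A * v + B with hf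
  have hxder : ∀ t, HasDerivAt x (xd t) t := fun t => hasDerivAt_ovalChart e₁ e₂ t
  have hfx : ∀ t, HasDerivAt (fun u => f (x u)) ((3 * x t ^ 2 + A) * xd t) t := fun t =>
    (hasDerivAt_cubic A B (x t)).comp t (hxder t)
  -- the period integrand on the two open halves
  have key : ∀ t ∈ Set.Ioo (0 : ℝ) 1, t ≠ 1 / 2 → ∀ (σ : ℝ), (σ = 1 ∨ σ = -1) →
      (∀ᶠ u in nhds t, γ.toFun u = ![((x u : ℝ) : ℂ), ((σ * Real.sqrt (f (x u)) : ℝ) : ℂ)]) →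
      (∑ i, MvPolynomial.eval (sy.γ.toFun t) (sy.ω i) * deriv (fun u => sy.γ.toFun u i) t) =
        ((ρ.integrand (fun _ => x t) * (σ * xd t) : ℝ) : ℂ) := by
    intro t ht ht2 σ hσ hloc
    have hxm : x t ∈ Set.Ioo e₁ e₂ := ovalChart_mem hlt ht ht2
    have hfpos : 0 < f (x t) := hpos _ hxm
    set y : ℝ := Real.sqrt (f (x t)) with hy
    have hy0 : 0 < y := Real.sqrt_pos.2 hfpos
    have hy2 : y ^ 2 = f (x t) := Real.sq_sqrt hfpos.le
    have hσ2 : σ ^ 2 = 1 := by rcases hσ with rfl | rfl <;> norm_num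
    have hσy0 : σ * y ≠ 0 := by
      rcases hσ with rfl | rfl
      · simpa using hy0.ne'
      · simpa using hy0.ne'
    have hsy2 : (σ * y) ^ 2 = x t ^ 3 + A * x t + B := by rw [mul_pow, hσ2, one_mul, hy2]
    -- derivatives of the two coordinates
    have hX : HasDerivAt (fun u => ((x u : ℝ) : ℂ)) ((xd t : ℝ) : ℂ) t := (hxder t).ofReal_comp
    have hYr : HasDerivAt (fun u => σ * Real.sqrt (f (x u))) (σ * ((3 * x t ^ 2 + A) * xd t / (2 * y))) t :=
      ((hfx t).sqrt hfpos.ne').const_mul σ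
    have hY : HasDerivAt (fun u => ((σ * Real.sqrt (f (x u)) : ℝ) : ℂ))
        (((σ * ((3 * x t ^ 2 + A) * xd t / (2 * y))) : ℝ) : ℂ) t := hYr.ofReal_comp
    have hsum := sum_eval_deriv_eq γ G H hloc hX hY
    have hform := hGH (x t) (σ * y) hsy2 hσy0
    show (∑ i, MvPolynomial.eval (γ.toFun t) ((![G, H] : Fin 2 → MvPolynomial (Fin 2) ℂ) i) *
        deriv (fun u => γ.toFun u i) t) = _
    rw [hsum]
    -- `G + H f′/(2σy) = P₂ σy + P₃/(σy) = σ (P₂ y + P₃/y)`, times `x′`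
    have hρ : ρ.integrand (fun _ => x t) = Polynomial.aeval (x t) P₂ * y + Polynomial.aeval (x t) P₃ / y :=
      hint _ hxm
    have hval : (Polynomial.aeval (x t) (0 : Polynomial (algebraicClosure ℚ ℝ)) +
        Polynomial.aeval (x t) P₂ * (σ * y) + Polynomial.aeval (x t) P₃ / (σ * y) : ℝ) =
        σ * ρ.integrand (fun _ => x t) := by
      rw [map_zero, zero_add, hρ]
      rcases hσ with rfl | rfl
      · ring
      · field_simp
        ring
    rw [hval] at hform
    have e1 : (((σ * ((3 * x t ^ 2 + A) * xd t / (2 * y))) : ℝ) : ℂ) =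
        (((3 * x t ^ 2 + A) / (2 * (σ * y)) : ℝ) : ℂ) * ((xd t : ℝ) : ℂ) := by
      rw [← Complex.ofReal_mul]
      congr 1
      rcases hσ with rfl | rfl <;> field_simp
    rw [e1, ← mul_assoc, ← add_mul, hform]
    push_cast
    ring
  -- the realisation integrand on the two halves
  have hloc₁ : ∀ t ∈ Set.Ioo (0 : ℝ) (1 / 2), ∀ᶠ u in nhds t,
      γ.toFun u = ![((x u : ℝ) : ℂ), (((1 : ℝ) * Real.sqrt (f (x u)) : ℝ) : ℂ)] := by
    intro t ht
    filter_upwards [Ioo_mem_nhds ht.1 ht.2] with u hu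
    rw [hγ₁ u ⟨hu.1.le, hu.2.le⟩, one_mul]
  have hloc₂ : ∀ t ∈ Set.Ioo (1 / 2 : ℝ) 1, ∀ᶠ u in nhds t,
      γ.toFun u = ![((x u : ℝ) : ℂ), (((-1 : ℝ) * Real.sqrt (f (x u)) : ℝ) : ℂ)] := by
    intro t ht
    filter_upwards [Ioo_mem_nhds ht.1 ht.2] with u hu
    rw [hγ₂ u ⟨hu.1.le, hu.2.le⟩, neg_one_mul]
  have hR₁' : ∀ t ∈ Set.Ioo (0 : ℝ) (1 / 2), R₁.integrand (fun _ => t) =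
      1 / 2 * (ρ.integrand (fun _ => x t) * xd t) := by
    intro t ht
    have ht' : t ∈ Set.Ioo (0 : ℝ) 1 := ⟨ht.1, ht.2.trans (by norm_num)⟩
    have hz : (fun _ : Fin 1 => t) ∈ R₁.domain := by rw [hR₁dom]; exact ht'
    rw [hR₁ _ hz]
    show ((1 / 2 : ℂ) * ∑ i, MvPolynomial.eval (sy.γ.toFun t) (sy.ω i) * deriv (fun u => sy.γ.toFun u i) t).re = _
    rw [key t ht' ht.2.ne 1 (Or.inl rfl) (hloc₁ t ht), one_mul]
    simp only [Complex.mul_re, Complex.ofReal_re, Complex.ofReal_im, mul_zero, sub_zero]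
    norm_num
  have hR₂' : ∀ t ∈ Set.Ioo (1 / 2 : ℝ) 1, R₁.integrand (fun _ => t) =
      1 / 2 * (ρ.integrand (fun _ => x t) * -xd t) := by
    intro t ht
    have ht' : t ∈ Set.Ioo (0 : ℝ) 1 := ⟨(by norm_num : (0:ℝ) < 1 / 2).trans ht.1, ht.2⟩
    have hz : (fun _ : Fin 1 => t) ∈ R₁.domain := by rw [hR₁dom]; exact ht'
    rw [hR₁ _ hz]
    show ((1 / 2 : ℂ) * ∑ i, MvPolynomial.eval (sy.γ.toFun t) (sy.ω i) * deriv (fun u => sy.γ.toFun u i) t).re = _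
    rw [key t ht' ht.1.ne' (-1) (Or.inr rfl) (hloc₂ t ht), neg_one_mul]
    simp only [Complex.mul_re, Complex.ofReal_re, Complex.ofReal_im, mul_zero, sub_zero]
    norm_num
  have hsub : KZ.of ρ - KZ.of R₁ ∈ M₁ := stub_ovalRealise e₁ e₂ he₁ he₂ hlt ρ R₁ hdom hR₁dom hR₁' hR₂'
  -- the value
  have hval : R₁.value = ρ.value := by
    have h := Summit.KontsevichZagierPeriods.SymplecticScissors.RealOnePeriodRelationsNegative.eval_eq_zero_of_mem_M₁ hsub
    rw [map_sub, KZ.eval_of, KZ.eval_of, sub_eq_zero] at h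
    exact h.symm
  have hper : (1 / 2 : ℂ) * sy.period = ((R₁.value : ℝ) : ℂ) := by
    refine half_period_eq_value sy R₁ hR₁dom hR₁ (fun t => if t < 1 / 2 then ρ.integrand (fun _ => x t) * xd t
      else ρ.integrand (fun _ => x t) * -xd t) (fun t ht ht2 => ?_)
    rcases lt_or_gt_of_ne ht2 with h | h
    · rw [if_pos h, key t ht ht2 1 (Or.inl rfl) (hloc₁ t ⟨ht.1, h⟩), one_mul]
    · rw [if_neg (not_lt.2 h.le), key t ht ht2 (-1) (Or.inr rfl) (hloc₂ t ⟨h, ht.2⟩), neg_one_mul]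
  refine ⟨Finsupp.single sy (1 / 2), fun _ => R₁, ?_, ?_, ?_, ?_, ?_, ?_⟩
  · intro t
    by_cases h : t = sy
    · subst h; simpa using hhalf
    · rw [Finsupp.single_apply, if_neg (Ne.symm h)]; exact isAlgebraic_zero
  · intro t ht
    rw [Finsupp.support_single _ (by norm_num), Finset.mem_singleton] at ht
    subst ht
    exact ⟨rfl, hcl⟩
  · intro t ht
    rw [Finsupp.support_single _ (by norm_num), Finset.mem_singleton] at ht
    subst ht
    exact hSA
  · intro t ht
    rw [Finsupp.support_single _ (by norm_num), Finset.mem_singleton] at ht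
    subst ht
    refine ⟨hR₁dom, fun z hz => ?_⟩
    rw [hR₁ z hz, Finsupp.single_eq_same]
  · rw [evalCombination_single, hper, hval]
  · rw [Finsupp.support_single _ (by norm_num), Finset.sum_singleton]
    exact hsub


end LoopLayer

end Summit.KontsevichZagierPeriods.SymplecticScissors.RealOnePeriodRelations

end
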